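import Literature.NumberTheory.LFunctions.RosserSchoenfeldMertensChainSound
import Literature.NumberTheory.LFunctions.RosserSchoenfeldMertensChainRun1
import Literature.NumberTheory.LFunctions.RosserSchoenfeldMertensChainRun2
import Literature.NumberTheory.LFunctions.RosserSchoenfeldMertensChainRun3
import Literature.NumberTheory.LFunctions.RosserSchoenfeldMertensChainRun4
import Literature.NumberTheory.LFunctions.RosserSchoenfeldMertensChainRun5
import Literature.NumberTheory.LFunctions.RosserSchoenfeldMertensChainRun6
import Literature.NumberTheory.LFunctions.RosserSchoenfeldMertensChainRun7
import Literature.NumberTheory.LFunctions.RosserSchoenfeldMertensChainRun8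
import Literature.NumberTheory.LFunctions.RosserSchoenfeldMertensChainRun9
import Literature.NumberTheory.LFunctions.RosserSchoenfeldMertensChainRun10
import Literature.NumberTheory.LFunctions.RosserSchoenfeldMertensChainRun11
import Literature.NumberTheory.LFunctions.RosserSchoenfeldMertensChainRun12
import Literature.NumberTheory.LFunctions.RosserSchoenfeldMertensChainRun13
import Literature.NumberTheory.LFunctions.RosserSchoenfeldMertensChainRun14
import Literature.NumberTheory.LFunctions.RosserSchoenfeldMertensChainRun15
import Literature.NumberTheory.LFunctions.RosserSchoenfeldMertensChainRun16
import Literature.NumberTheory.LFunctions.RosserSchoenfeldMertensChainRun17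
import Literature.NumberTheory.LFunctions.RosserSchoenfeldMertensFirstConstantCorollaries
import HarnessLib

/-!
# Rosser–Schoenfeld 1962, Theorem 6 (3.21) on the tabulated range `1 < x < 4 599 989`,
# unconditionally, by kernel computation

Literature/NumberTheory/LFunctions. Pure proof file (nothing asserted, no definition): the assembly
of the certified (3.21)-runs. J. B. Rosser, L. Schoenfeld, *Approximate formulas for some functions of
prime numbers*, Illinois J. Math. 6 (1962), 64–94, Thm. 6, (3.21):
`log x + E − 1/(2 log x) < Σ_{p ≤ x} (log p)/p` for `x > 1` — the tree's named fact
`RosserSchoenfeld1962_eq_3_21` (`RosserSchoenfeldMertensFirst.lean`), with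
`E = −γ − Σ_p (log p)/(p(p−1))` (`rosserSchoenfeldE`). Rosser–Schoenfeld prove it for `x ≤ 16 000` by
the Rosser–Walker tabulation and for `x ≤ 10⁸` by the Appel–Rosser tabulation (Thm. 21; pp. 76,
87), their analytic argument (§§5–6, 8) taking over at `10⁸`. Here the range
**`1 < x < 4 599 989`** (`4 599 989` the last entry of the complete prime table `ChainTable.table`)
is **certified by the kernel**:

* the run `MertensChainRun.run1`, …, `run17` over the `322 440` odd primes of the table
  (`RosserSchoenfeldMertensChainCheck.lean`, `RosserSchoenfeldMertensChainSound.lean`):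
  `MertensChainRun.inv_final`, the invariant `MertensChain.Inv` at the prime `4599989`;
* **`RosserSchoenfeld1962_eq_3_21_tabulated`** — for all real `1 < x < 4599989`,
  `log x + E − 1/(2 log x) < Σ_{p ≤ x} (log p)/p` (below `2` the sum is empty and the left side is
  negative, `RosserSchoenfeld1962_eq_3_21_of_two_le`);
* **`RosserSchoenfeld1962_eq_3_21_of_theta_ge`** — consequently the named fact follows from an
  explicit `θ`-bound on the *remaining* range only: if `|θ(y) − y| ≤ η y/log² y` for all
  `y ≥ 4599989` with `η (1 + 1/log 4599989) < 1/2` (any `η ≤ 0.469`), then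
  `RosserSchoenfeld1962_eq_3_21` holds (via `RosserSchoenfeld1962_thm6_of_theta`,
  `RosserSchoenfeldMertensFirstConstant.lean`). Such a bound is Rosser–Schoenfeld's Table I/Thm. 11
  territory (§6: their zero-free region and Lehmer's zeros); the tree does not have it yet;
* **`RosserSchoenfeld1962_eq_3_21_of_dusart`** — in particular P. Dusart's published estimate
  `|θ(x) − x| < 0.2 x/log² x` (`x ≥ 3 594 641`; arXiv:1002.0442, Thm. 5.2) implies the named fact,
  the threshold `3 594 641` lying inside the tabulated range.

## References
* J. B. Rosser, L. Schoenfeld, Illinois J. Math. 6 (1962), 64–94: Thm. 6 (3.21), p. 70; Thm. 21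
  and pp. 76, 87 (the tabulated ranges); §§5–6, 8 (the analytic range). [RosserSchoenfeld1962]
* P. Dusart, *Estimates of some functions over primes without R.H.*, arXiv:1002.0442 (2010),
  Thm. 5.2 (published: Ramanujan J. 45 (2018), 227–251). [Dusart2010]
-/

noncomputable section

namespace Literature.NumberTheory.LFunctions

open scoped Chebyshev

namespace MertensChainRun

open MertensChain

/-- **The invariant at the end of the certified run** (the prime `4599989`, the last table entry).
[cite: RosserSchoenfeld1962, Thm. 6 (3.21)] -/
theorem inv_final :
    Inv ⟨4599989, 18546813401249085173168885, 18546813401249560786956128,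
      16936353504601984978215182, 913181936328724732244514⟩ :=
  runD_sound (runD_sound (runD_sound (runD_sound (runD_sound (runD_sound (runD_sound (runD_sound
    (runD_sound (runD_sound (runD_sound (runD_sound (runD_sound (runD_sound (runD_sound (runD_sound
    (runD_sound initS_inv run1) run2) run3) run4) run5) run6) run7) run8) run9) run10) run11) run12)
    run13) run14) run15) run16) run17

end MertensChainRun

/-- **Rosser–Schoenfeld 1962, Theorem 6 (3.21), on `1 < x < 4 599 989`** (unconditionally, by the
kernel-certified tabulation of this file; RS62 tabulate to `10⁸`): for real `1 < x < 4599989`,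
`log x + E − 1/(2 log x) < Σ_{p ≤ x} (log p)/p`.
[cite: RosserSchoenfeld1962, Thm. 6 (3.21); pp. 76, 87] -/
theorem RosserSchoenfeld1962_eq_3_21_tabulated {x : ℝ} (hx : 1 < x) (hx' : x < 4599989) :
    Real.log x + rosserSchoenfeldE - 1 / (2 * Real.log x) <
      ∑ p ∈ Nat.primesLE ⌊x⌋₊, Real.log p / p := by
  by_cases h2 : 2 ≤ x
  · exact MertensChain.lt_sum_of_inv MertensChainRun.inv_final h2 (by exact_mod_cast hx')
  · push Not at h2
    have hfl : ⌊x⌋₊ = 1 := by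
      rw [Nat.floor_eq_iff (by linarith)]
      constructor
      · exact_mod_cast hx.le
      · push_cast; linarith
    rw [hfl, Nat.primesLE_one, Finset.sum_empty]
    have hl0 : 0 < Real.log x := Real.log_pos hx
    have hl2 : Real.log x < Real.log 2 := Real.log_lt_log (by linarith) h2
    have hlog2 := Real.log_two_lt_d9
    have hE := rosserSchoenfeldE_lt_neg_one
    have hpos : 0 < 1 / (2 * Real.log x) := by positivity
    linarith

/-- **The named fact (3.21) from an explicit `θ`-bound on `y ≥ 4 599 989` only**: if
`|θ(y) − y| ≤ η y/log² y` for all `y ≥ 4599989` and `η (1 + 1/log 4599989) < 1/2` (e.g. any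
`0 ≤ η ≤ 0.469`), then `log x + E − 1/(2 log x) < Σ_{p ≤ x} (log p)/p` for every real `x > 1`
(the tabulated range below `4599989`, `RosserSchoenfeld1962_eq_3_21_tabulated`; the glue
`RosserSchoenfeld1962_thm6_of_theta` above). The hypothesis is the shape of Rosser–Schoenfeld's
Table I bounds (§6), not yet in the tree.
[cite: RosserSchoenfeld1962, Thm. 6 (3.21), proof (§8, p. 87)] -/
theorem RosserSchoenfeld1962_eq_3_21_of_theta_ge {η : ℝ} (hη : 0 ≤ η)
    (hθ : ∀ y : ℝ, 4599989 ≤ y → |θ y - y| ≤ η * y / Real.log y ^ 2)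
    (hsmall : η * (1 + 1 / Real.log 4599989) < 1 / 2) :
    RosserSchoenfeld1962_eq_3_21 := by
  intro x hx
  by_cases hX : x < 4599989
  · exact RosserSchoenfeld1962_eq_3_21_tabulated hx hX
  · push Not at hX
    exact (RosserSchoenfeld1962_thm6_of_theta (by norm_num) hη hθ hsmall hX).1

/-- **The named fact (3.21) from Dusart's bound.** P. Dusart, *Estimates of some functions over
primes without R.H.*, arXiv:1002.0442 (2010), Thm. 5.2 (`k = 2`, `η₂ = 0.2`; Ramanujan J. 45 (2018))
proves `|θ(x) − x| < 0.2 x/log² x` for all `x ≥ 3 594 641` (key `Dusart2010`). That bound — a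
HYPOTHESIS here, it is not in the tree — implies Rosser–Schoenfeld's (3.21) for every `x > 1`,
since `3 594 641 < 4 599 989` lies inside the kernel-tabulated range and
`0.2 (1 + 1/log 4599989) < 1/2`. (So the named fact `RosserSchoenfeld1962_eq_3_21` is now reduced to
that one published explicit estimate; Rosser–Schoenfeld's own route uses their Table I up to `10⁸`.)
[cite: RosserSchoenfeld1962, Thm. 6 (3.21)] -/
theorem RosserSchoenfeld1962_eq_3_21_of_dusart
    (hθ : ∀ x : ℝ, 3594641 ≤ x → |θ x - x| < 0.2 * x / Real.log x ^ 2) :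
    RosserSchoenfeld1962_eq_3_21 := by
  refine RosserSchoenfeld1962_eq_3_21_of_theta_ge (η := 0.2) (by norm_num)
    (fun y hy ↦ (hθ y (by linarith)).le) ?_
  have hL : 1 < Real.log 4599989 := by
    rw [Real.lt_log_iff_exp_lt (by norm_num)]
    have := Real.exp_one_lt_d9
    linarith
  have h1 : 1 / Real.log 4599989 < 1 := by
    rw [div_lt_one (by linarith)]
    exact hL
  linarith

end Literature.NumberTheory.LFunctions

end
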